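import Literature.MathematicalPhysics.QuantumFieldTheory.Balaban1983to89.B8Prop7ClassAkLocal

/-!
# `Balaban1983to89.B8Prop7ClassAkLiteral` — [Balaban1985RegularSpaces] Prop. 7 (1.144) p. 100, `𝔄_k`-clause, with
# (1.140) «on Ω_j» in the LITERAL p. 77 bond convention: the one-layer gap of `B8Eq140Level` HONEST SCOPE (i) closed at
# the price of `L`-dependent constants (`α₀ + 3α₂ ↦ α₀ + 3L²α₂`) under the nesting (1.3)/(1.4) and `Ω₀ = T_η`

statement-level skeleton of published theorems with citation tags; proofs where landed; nothing here is a claim about the Yang–Mills mass gap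

T. Bałaban, *Spaces of regular gauge field configurations on a lattice and gauge fixing conditions*, Commun.
Math. Phys. **99** (1985) 75–102 `[Balaban1985RegularSpaces]` ("B8"; printed page = PDF page + 74).
PDF held: `paper:balaban1985-cmp99-regular-spaces-gauge-fixing` (lit store), pp. 77 and 100 read as text (`p0003.txt`,
`p0026.txt`).  STATUS: published, refereed; this file is a COROLLARY of `B8Prop7ClassAkLocal.inAk_mulCfg_loc`: it
replaces the one-layer-enlarged reading of «on Ω_j» used there for `|A|`, `|∇^η_{U₀}A|` (`B8Eq140Level.SideTouches`,
GAPS.md G-B8-16) by print's LITERAL bond convention of p. 77 («at least one end-point of b belongs to Ω»), using the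
previous level: the sides of the plaquettes touching `Ω_{i+1}` touch `Ω_i` (they touch the one-layer enlargement of
`Ω_{i+1}`, which lies in `Ω_i` by the admissibility (1.3)/(1.4): «(Lʲη)⁻¹dist(Ω_jᶜ, Ω_{j+1}) > RM₁»), where (1.140)
gives the weaker threshold `α₂(Lⁱη)⁻¹ = L·α₂(L^{i+1}η)⁻¹` (and `L²` for the gradient); at the bottom level one needs
`Ω₀ = T_η` (print's standing case for the whole-lattice problem).  Nothing here is new mathematics and nothing here is a
claim about the Clay problem.

WHAT IS REPRODUCED (lit-balaban SKELETON rows): **B8.Prop7**, `𝔄_k`-clause of (1.144), and **B8.Eq1.140** in the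
literal convention (`Cond140Lit`).  Unit `lit-balaban-p40` (Phase-2 proof seat p40, gen 5), HOME
`run/shared/lean/pub/lit-balaban/` (owner fold `lit-balaban-r05/ROWS-B8.md`).

## THE PRINTED TEXT (p. 77 [PDF 3], p. 100 [PDF 26], quoted from the text layer)

«Ω₀ ⊃ Ω₁ ⊃ … ⊃ Ω_k, Ω_j ⊂ T_η, (1.3) … Ω_j is a sum of cubes of a size M₁Lʲη, (Lʲη)⁻¹dist(Ω_jᶜ, Ω_{j+1}) > RM₁. (1.4) …
If Ω ⊂ T_η, then we denote by Ω also the set of bonds ⋃_{x∈Ω} st(x) = {bonds b ⊂ T_η: at least one end-point of b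
belongs to Ω}.» (p. 77)  «… A satisfying Lʲη|A|, (Lʲη)²|∇^η_{U₀}A|, (Lʲη)³|D^{η*}_{U₀}D^η_{U₀}A| < α₂ on Ω_j. (1.140) …
Proposition 7. If the configurations U₀, A satisfy (1.139), (1.140), then for α₀, α₂ sufficiently small we have
U′U₀ = (U₁U₀)^u ∈ 𝔄_k({Ω_j}, α₀ + 3α₂) ∩ Ax_k(𝔅_k, U₀), (1.144)» (p. 100)

## WHAT IS CERTIFIED HERE (kernel; axioms `propext` / `Classical.choice` / `Quot.sound`)

* `Cond140Lit L η α₂ j S U₀ A` = (1.140) at level `j` with ALL THREE members attached to the bonds touching `S`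
  (`B8Ineq132.BondTouches`, the literal p. 77 convention; a gradient entry `(D_κA_τ)(y)` is attached to `⟨y, y + e_τ⟩`).
* `cond140_mono` (monotone in `α₂`), `cond140_of_lit_univ` (on `S = T_η` the two readings agree),
  **`cond140_of_lit_succ`**: `Cond140Lit` at level `i` on `T` and at level `i + 1` on `S`, with every side of a plaquette
  touching `S` touching `T`, give `Cond140 L η (L²α₂) (i + 1) S` (level arithmetic `(Lⁱη)⁻¹ = L(L^{i+1}η)⁻¹ ≤ L²(L^{i+1}η)⁻¹`,
  `((Lⁱη)⁻¹)² = L²((L^{i+1}η)⁻¹)²`).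
* **`inAk_mulCfg_literal`** / `inAk_mulCfg_gaugeAct_hermitian_literal`: for `Ω₀ = T_η`, the nesting
  «`SideTouches (Ω (i+1)) ⊆ BondTouches (Ω i)`, `i < k`», `U₀ ∈ 𝔄_k({Ω_j}, α₀)`, `Cond140Lit` at every level `j ≤ k`,
  `0 ≤ α₀, L²α₂ ≤ 1/(80d)`: `U₁U₀ ∈ 𝔄_k({Ω_j}, α₀ + 3L²α₂)` (and `(U₁U₀)^u` for Hermitian `A`, every `U1`-valued `u`).

## HONEST SCOPE — what is NOT claimed

(i) The constant of (1.144) becomes `α₀ + 3L²α₂` (print: `α₀ + 3α₂`); print's «α₀, α₂ sufficiently small» is unaffected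
in kind (the smallness now depends on `L` as well as `d`), and with the enlarged reading of `B8Prop7ClassAkLocal` the
printed `α₀ + 3α₂` holds exactly.  (ii) The nesting hypothesis is the consequence of (1.4) actually used (one lattice
layer; print has `RM₁Lʲη`); `Ω₀ = T_η` is assumed (for `Ω₀ ⊊ T_η` print's (1.140) gives no control of `A` on the outer
sides of the plaquettes touching `∂Ω₀`).  (iii) Everything else as in `B8Prop7ClassAkLocal` HONEST SCOPE (ii)–(iv).
-/

noncomputable section

open scoped BigOperators
open NormedSpace Finset

namespace Literature.MathematicalPhysics.QuantumFieldTheory.Balaban1983to89.B8Prop7ClassAkLiteral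

open B7Prop1Explicit
open B8Lemma1NonAbelian (mulCfg)
open B8Ineq132 (covDerivFwd CondAt InAk PlaqTouches BondTouches inAk_gaugeAct_iff)
open B8Eq143PlaqExpansion (pdiv)
open B8Eq146AExpansion (expCfg iEta plaqCovDeriv)
open B8Eq155JBound (expCfg_iEta_mem_U1)
open B8Eq140Level
open B8Prop7ClassAkLocal

-- `Site` alone would resolve to the torus sites of `Setup.lean`; re-export the `ℤ^d` sites of `B7Prop1Explicit`.
export B7Prop1Explicit (Site)

variable {d : ℕ}

section Literal

variable {𝔸 : Type*} [NormedRing 𝔸] [NormedAlgebra ℂ 𝔸]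

/-- **(1.140) AT LEVEL `j` ON `S` IN THE LITERAL p. 77 CONVENTION**: all three members on the bonds with at least one
end-point in `S` (`|A(b)| < α₂(Lʲη)⁻¹`, `|(D^η_{U₀,κ}A_τ)(y)| < α₂(Lʲη)⁻²` for `b = ⟨y, y + e_τ⟩` touching `S`,
`|(D^{η*}_{U₀}D^η_{U₀}A)(b)| < α₂(Lʲη)⁻³`). [cite: Balaban1985RegularSpaces, (1.140) p.100 (with p.77 convention)] -/
def Cond140Lit (L : ℕ) (η α₂ : ℝ) (j : ℕ) (S : Set (Site d)) (U₀ : Site d → Fin d → 𝔸ˣ)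
    (A : Site d → Fin d → 𝔸) : Prop :=
  (∀ (y : Site d) (τ : Fin d), BondTouches S y τ → ‖A y τ‖ < α₂ * ((L : ℝ) ^ j * η)⁻¹) ∧
    (∀ (y : Site d) (κ τ : Fin d), BondTouches S y τ →
        ‖covDerivFwd η U₀ κ (fun z => A z τ) y‖ < α₂ * (((L : ℝ) ^ j * η)⁻¹) ^ 2) ∧
      ∀ (y : Site d) (μ : Fin d), BondTouches S y μ →
        ‖pdiv η U₀ (plaqCovDeriv η U₀ A) μ y‖ < α₂ * (((L : ℝ) ^ j * η)⁻¹) ^ 3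

/-- `Cond140` is monotone in the constant `α₂`. [cite: Balaban1985RegularSpaces, (1.140) p.100] -/
theorem cond140_mono {L : ℕ} {η α₂ α₂' : ℝ} (hη : 0 < η) (hα : α₂ ≤ α₂') {j : ℕ} {S : Set (Site d)}
    {U₀ : Site d → Fin d → 𝔸ˣ} {A : Site d → Fin d → 𝔸} (h : Cond140 L η α₂ j S U₀ A) :
    Cond140 L η α₂' j S U₀ A := by
  have hr : 0 ≤ ((L : ℝ) ^ j * η)⁻¹ := inv_nonneg.mpr (by positivity)
  exact ⟨fun y τ hy => (h.1 y τ hy).trans_le (mul_le_mul_of_nonneg_right hα hr),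
    fun y κ τ hy => (h.2.1 y κ τ hy).trans_le (mul_le_mul_of_nonneg_right hα (by positivity)),
    fun y μ hy => (h.2.2 y μ hy).trans_le (mul_le_mul_of_nonneg_right hα (by positivity))⟩

/-- On the whole lattice `S = T_η` the literal and the enlarged readings of (1.140) agree (every bond touches `T_η`).
[cite: Balaban1985RegularSpaces, (1.140) p.100] -/
theorem cond140_of_lit_univ {L : ℕ} {η α₂ : ℝ} {j : ℕ} {U₀ : Site d → Fin d → 𝔸ˣ} {A : Site d → Fin d → 𝔸}
    (h : Cond140Lit L η α₂ j (Set.univ : Set (Site d)) U₀ A) : Cond140 L η α₂ j Set.univ U₀ A :=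
  ⟨fun y τ _ => h.1 y τ (Or.inl (Set.mem_univ y)), fun y κ τ _ => h.2.1 y κ τ (Or.inl (Set.mem_univ y)), h.2.2⟩

/-- The level arithmetic of the previous level: `α₂(Lⁱη)⁻¹ ≤ L²α₂(L^{i+1}η)⁻¹` and `α₂((Lⁱη)⁻¹)² = L²α₂((L^{i+1}η)⁻¹)²`
(`L ≥ 1`, `α₂ ≥ 0`, `η > 0`). [cite: Balaban1985RegularSpaces, (1.140) p.100] -/
theorem thr140_prev {L : ℕ} (hL : 1 ≤ L) {η α₂ : ℝ} (hη : 0 < η) (hα₂ : 0 ≤ α₂) (i : ℕ) :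
    α₂ * ((L : ℝ) ^ i * η)⁻¹ ≤ (L : ℝ) ^ 2 * α₂ * ((L : ℝ) ^ (i + 1) * η)⁻¹ ∧
      α₂ * (((L : ℝ) ^ i * η)⁻¹) ^ 2 = (L : ℝ) ^ 2 * α₂ * (((L : ℝ) ^ (i + 1) * η)⁻¹) ^ 2 := by
  have hL0 : (0 : ℝ) < L := by exact_mod_cast hL
  have hL1 : (1 : ℝ) ≤ L := by exact_mod_cast hL
  have hkey : ((L : ℝ) ^ i * η)⁻¹ = (L : ℝ) * ((L : ℝ) ^ (i + 1) * η)⁻¹ := by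
    rw [pow_succ]; field_simp
  refine ⟨?_, ?_⟩
  · rw [hkey]
    have hr : 0 ≤ ((L : ℝ) ^ (i + 1) * η)⁻¹ := inv_nonneg.mpr (by positivity)
    have : (L : ℝ) * ((L : ℝ) ^ (i + 1) * η)⁻¹ ≤ (L : ℝ) ^ 2 * ((L : ℝ) ^ (i + 1) * η)⁻¹ :=
      mul_le_mul_of_nonneg_right (by nlinarith) hr
    nlinarith
  · rw [hkey]; ring

/-- **THE LITERAL READING AT LEVEL `i` GIVES THE ENLARGED READING AT LEVEL `i + 1` WITH `L²α₂`**: if every side of a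
plaquette touching `S` (print: `Ω_{i+1}`) touches `T` (print: `Ω_i`; the one-layer enlargement of `Ω_{i+1}` lies in `Ω_i`
by (1.3)/(1.4)), then `Cond140Lit` at level `i` on `T` and at level `i + 1` on `S` imply `Cond140 L η (L²α₂) (i + 1) S`.
[cite: Balaban1985RegularSpaces, (1.140) p.100, (1.3)-(1.4) p.77] -/
theorem cond140_of_lit_succ {L : ℕ} (hL : 1 ≤ L) {η α₂ : ℝ} (hη : 0 < η) (hα₂ : 0 ≤ α₂) {i : ℕ}
    {S T : Set (Site d)} (hnest : ∀ (y : Site d) (τ : Fin d), SideTouches S y τ → BondTouches T y τ)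
    {U₀ : Site d → Fin d → 𝔸ˣ} {A : Site d → Fin d → 𝔸} (hT : Cond140Lit L η α₂ i T U₀ A)
    (hS : Cond140Lit L η α₂ (i + 1) S U₀ A) : Cond140 L η ((L : ℝ) ^ 2 * α₂) (i + 1) S U₀ A := by
  obtain ⟨h1, h2⟩ := thr140_prev hL hη hα₂ i
  have hL1 : (1 : ℝ) ≤ (L : ℝ) ^ 2 := one_le_pow₀ (by exact_mod_cast hL)
  refine ⟨fun y τ hy => (hT.1 y τ (hnest y τ hy)).trans_le h1,
    fun y κ τ hy => (hT.2.1 y κ τ (hnest y τ hy)).trans_eq h2, fun y μ hy => (hS.2.2 y μ hy).trans_le ?_⟩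
  have : 0 ≤ α₂ * (((L : ℝ) ^ (i + 1) * η)⁻¹) ^ 3 := by positivity
  nlinarith

/-- **(1.140) IN THE LITERAL CONVENTION ALONG AN ADMISSIBLE FAMILY ⇒ the enlarged reading with `L²α₂` at every
level**: for `Ω₀ = T_η` and a family with `SideTouches (Ω (i+1)) ⊆ BondTouches (Ω i)` for `i < k` (one lattice layer of
the collar (1.4)), `Cond140Lit` at every level `j ≤ k` gives `Cond140 L η (L²α₂) j (Ω j)` for every `j ≤ k`.
[cite: Balaban1985RegularSpaces, (1.140) p.100, (1.3)-(1.4) p.77] -/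
theorem cond140_family_of_lit {L : ℕ} (hL : 1 ≤ L) {η α₂ : ℝ} (hη : 0 < η) (hα₂ : 0 ≤ α₂) {k : ℕ}
    {Ω : ℕ → Set (Site d)} (hΩ₀ : Ω 0 = Set.univ)
    (hnest : ∀ i, i < k → ∀ (y : Site d) (τ : Fin d), SideTouches (Ω (i + 1)) y τ → BondTouches (Ω i) y τ)
    {U₀ : Site d → Fin d → 𝔸ˣ} {A : Site d → Fin d → 𝔸} (h : ∀ j, j ≤ k → Cond140Lit L η α₂ j (Ω j) U₀ A)
    (j : ℕ) (hj : j ≤ k) : Cond140 L η ((L : ℝ) ^ 2 * α₂) j (Ω j) U₀ A := by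
  cases j with
  | zero =>
    have hL1 : (1 : ℝ) ≤ (L : ℝ) ^ 2 := one_le_pow₀ (by exact_mod_cast hL)
    have h0 : Cond140 L η α₂ 0 (Ω 0) U₀ A := by
      rw [hΩ₀]
      exact cond140_of_lit_univ (by simpa only [hΩ₀] using h 0 hj)
    exact cond140_mono hη (by nlinarith) h0
  | succ i =>
    exact cond140_of_lit_succ hL hη hα₂ (hnest i (by omega)) (h i (by omega)) (h (i + 1) hj)

end Literal

section ClassAk

variable {𝔸 : Type*} [NormedRing 𝔸] [NormOneClass 𝔸] [NormedAlgebra ℂ 𝔸] [CompleteSpace 𝔸]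

/-- **(1.144), `𝔄_k`-clause, WITH (1.140) IN THE LITERAL p. 77 CONVENTION**: for `U1`-valued `U₀`, `U₁ = e^{iηA}`
`U1`-valued with the (1.41)-bookkeeping `|U₁ − 1| ≤ L²α₂(Lʲη)⁻¹η` on `SideTouches (Ω j)`, `Ω₀ = T_η`, the one-layer
nesting of the family, `U₀ ∈ 𝔄_k({Ω_j}, α₀)` and `Cond140Lit` at every level, `0 ≤ α₀ ≤ 1/(80d)`, `0 ≤ α₂`,
`L²α₂ ≤ 1/(80d)`: `U₁U₀ ∈ 𝔄_k({Ω_j}, α₀ + 3L²α₂)`. [cite: Balaban1985RegularSpaces, Prop. 7 (1.144) p.100] -/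
theorem inAk_mulCfg_literal {η : ℝ} (hη : 0 < η) {L : ℕ} (hL : 1 ≤ L) {k : ℕ} {U₀ : Site d → Fin d → 𝔸ˣ}
    (h₀ : ∀ y κ, U₀ y κ ∈ U1 𝔸) {A : Site d → Fin d → 𝔸} (h₁ : ∀ y κ, expCfg (iEta η A) y κ ∈ U1 𝔸)
    {α₀ α₂ : ℝ} (hα₀ : 0 ≤ α₀) (hα₀c : α₀ ≤ 1 / (80 * d)) (hα₂ : 0 ≤ α₂) (hα₂c : (L : ℝ) ^ 2 * α₂ ≤ 1 / (80 * d))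
    {Ω : ℕ → Set (Site d)} (hΩ₀ : Ω 0 = Set.univ)
    (hnest : ∀ i, i < k → ∀ (y : Site d) (τ : Fin d), SideTouches (Ω (i + 1)) y τ → BondTouches (Ω i) y τ)
    (h139 : InAk L k η α₀ Ω U₀) (h140 : ∀ j, j ≤ k → Cond140Lit L η α₂ j (Ω j) U₀ A)
    (hu : ∀ j, j ≤ k → ∀ y τ, SideTouches (Ω j) y τ →
      ‖(expCfg (iEta η A) y τ : 𝔸) - 1‖ ≤ (L : ℝ) ^ 2 * α₂ * ((L : ℝ) ^ j * η)⁻¹ * η) :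
    InAk L k η (α₀ + 3 * ((L : ℝ) ^ 2 * α₂)) Ω (mulCfg (expCfg (iEta η A)) U₀) :=
  inAk_mulCfg_loc hη hL h₀ h₁ hα₀ hα₀c (by positivity) hα₂c h139
    (cond140_family_of_lit hL hη hα₂ hΩ₀ hnest h140) hu

end ClassAk

end Literature.MathematicalPhysics.QuantumFieldTheory.Balaban1983to89.B8Prop7ClassAkLiteral

namespace Literature.MathematicalPhysics.QuantumFieldTheory.Balaban1983to89.B8Prop7ClassAkLiteral

open B7Prop1Explicit
open B8Lemma1NonAbelian (mulCfg)
open B8Ineq132 (InAk BondTouches inAk_gaugeAct_iff)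
open B8Eq146AExpansion (expCfg iEta)
open B8Eq155JBound (expCfg_iEta_mem_U1)
open B8Eq140Level (SideTouches)
open B8Prop7ClassAkLocal (norm_expCfg_sub_one_of_cond140)

variable {d : ℕ} {𝔸 : Type*} [CStarAlgebra 𝔸] [Nontrivial 𝔸]

/-- **(1.144) for Hermitian `A`, (1.140) in the literal convention: `U′U₀ = (U₁U₀)^u ∈ 𝔄_k({Ω_j}, α₀ + 3L²α₂)` for
every `U1`-valued `u`**, under `Ω₀ = T_η`, the one-layer nesting, `U₀ ∈ 𝔄_k({Ω_j}, α₀)`, `Cond140Lit` at every level,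
`0 ≤ α₀ ≤ 1/(80d)`, `0 ≤ α₂`, `L²α₂ ≤ 1/(80d)`. [cite: Balaban1985RegularSpaces, Prop. 7 (1.144) p.100] -/
theorem inAk_mulCfg_gaugeAct_hermitian_literal {η : ℝ} (hη : 0 < η) {L : ℕ} (hL : 1 ≤ L) {k : ℕ}
    {U₀ : Site d → Fin d → 𝔸ˣ} (h₀ : ∀ y κ, U₀ y κ ∈ U1 𝔸) {A : Site d → Fin d → 𝔸}
    (hAh : ∀ y κ, IsSelfAdjoint (A y κ)) {α₀ α₂ : ℝ} (hα₀ : 0 ≤ α₀) (hα₀c : α₀ ≤ 1 / (80 * d)) (hα₂ : 0 ≤ α₂)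
    (hα₂c : (L : ℝ) ^ 2 * α₂ ≤ 1 / (80 * d)) {Ω : ℕ → Set (Site d)} (hΩ₀ : Ω 0 = Set.univ)
    (hnest : ∀ i, i < k → ∀ (y : Site d) (τ : Fin d), SideTouches (Ω (i + 1)) y τ → BondTouches (Ω i) y τ)
    (h139 : InAk L k η α₀ Ω U₀) (h140 : ∀ j, j ≤ k → Cond140Lit L η α₂ j (Ω j) U₀ A)
    {u : Site d → 𝔸ˣ} (hu1 : ∀ x, u x ∈ U1 𝔸) :
    InAk L k η (α₀ + 3 * ((L : ℝ) ^ 2 * α₂)) Ω (gaugeAct u (mulCfg (expCfg (iEta η A)) U₀)) := by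
  have h140' := cond140_family_of_lit hL hη hα₂ hΩ₀ hnest h140
  exact (inAk_gaugeAct_iff L k η _ Ω hu1 _).2
    (inAk_mulCfg_literal hη hL h₀ (expCfg_iEta_mem_U1 η hAh) hα₀ hα₀c hα₂ hα₂c hΩ₀ hnest h139 h140
      fun j hjk => norm_expCfg_sub_one_of_cond140 hη.le hAh (h140' j hjk))

#print axioms cond140_family_of_lit
#print axioms inAk_mulCfg_literal
#print axioms inAk_mulCfg_gaugeAct_hermitian_literal

end Literature.MathematicalPhysics.QuantumFieldTheory.Balaban1983to89.B8Prop7ClassAkLiteral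

end
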